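import Summits.Ventures.CertifiedArithmetic.Expansions.CompressNotIdempotent
import Summits.Ventures.CertifiedArithmetic.Expansions.CompressNotIdempotentPrecTwo

/-!
# COMPRESS is not idempotent at every precision `p ≥ 2` (packaging)

New work of the certified-arithmetic venture (ENGINES group: shared numerical engines serving
client cells; rigour lives in the verifiers; every published number belongs to a client cell's
ledger, not to the engines group).

`CompressNotIdempotent` (`p ≥ 3`, the family `⟨3, −2^p, −(2^p−1)·2^(p+1)⟩`) and
`CompressNotIdempotentPrecTwo` (`p = 2`, the witness `⟨1, 4, 8, 32⟩`) together: under
round-to-nearest-even with gradual underflow (`emin ≤ 0`), for EVERY precision `p ≥ 2` there is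
a nonoverlapping expansion of floats on which a second pass of COMPRESS [Shewchuk1997, §2.7
Theorem 23] changes (indeed shortens) the output of the first.  HONEST FRAMING: Theorem 23 claims
neither idempotence nor minimality; this is a property of the printed algorithm under the printed
tie rule.
-/

namespace Summit.Ventures.CertifiedArithmetic.Expansions

open Literature.ComputerArithmetic.JeannerodRump2018
open Literature.ComputerArithmetic.BoldoJeannerodMelquiondMuller2023 hiding twoSum twoSum_fst
open Literature.ComputerArithmetic.Shewchuk1997

variable {p : ℕ} {emin : ℤ}

/-- **COMPRESS is not idempotent, every precision `p ≥ 2`** (round-to-even, `emin ≤ 0`): some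
valid input's output is shortened by one component on a second pass.
[cite: Shewchuk1997, Thm 23 p. 331; §2.7 p. 331 (Priest "compresses optimally")] -/
theorem compress_not_idempotent_all (hp : 2 ≤ p) (he : emin ≤ 0) :
    ∃ e : List ℚ, (∀ x ∈ e, IsFloat p emin x) ∧ IsExpansion 1 e ∧
      compress (roundTiesEven p emin) (compress (roundTiesEven p emin) e) ≠
        compress (roundTiesEven p emin) e ∧
      (compress (roundTiesEven p emin) (compress (roundTiesEven p emin) e)).length + 1 =
        (compress (roundTiesEven p emin) e).length := by
  rcases Nat.eq_or_lt_of_le hp with h2 | h3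
  · subst h2
    obtain ⟨e, hF, hE, hne, h2, h3, -⟩ := compress_not_idempotent_prec_two (emin := emin) he
    exact ⟨e, hF, hE, hne, by rw [h2, h3]⟩
  · obtain ⟨e, hF, hE, hne, h2, h3', -⟩ := compress_not_idempotent (p := p) h3 he
    exact ⟨e, hF, hE, hne, by rw [h2, h3']⟩

end Summit.Ventures.CertifiedArithmetic.Expansions
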